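import Mathlib
import Summits.Ventures.PercRepro2.SwOutCrossDefs

/-!
# The core part of the cross-arm cube (blind cell PercRepro2, night-4 g23, 2026-08-28;
proofs/NIGHT4-G23.md §6)

The core points `(s, w)`, `w ∈ {a, b, d, f}`, of an up-set `𝒯` of types: over each `s` a top
segment of the chain `a > b > d > f`, the segments growing as `s` shrinks — so for each core fibre
point `w` the set `D w = {s | (s, label w) ∈ 𝒯}` is a lower set of the u-arm cube, with
`D a ⊇ D b ⊇ D d ⊇ D f`.  `ER (s, w)` grows with `s`; `EB (s, w) = ER (flipAll s, w.flip)` and the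
flip pairs `a ↔ f`, `b ↔ d`.  The cube principle (`card_inter_le_of_cube`, Harris twice) gives, for
each `w`, `#(D w ∩ {ER (·, w) ∈ 𝓔}) ≤ #(D w ∩ {ER (flipAll ·, w) ∈ 𝓔})`, and a rearrangement
(`card_rearr`: `D' ⊆ D`, `F ⊆ F'` ⟹ `#(D ∩ F) + #(D' ∩ F') ≤ #(D ∩ F') + #(D' ∩ F)`, applied to the
pairs `(a, f)` and `(b, d)`, with `ER (·, a) = ER (·, b) ⊆ ER (·, f) ⊆ ER (·, d)`) turns the
same-fibre right-hand sides into the flipped-fibre ones: **`core_card_le`**.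
-/

namespace Summit.Ventures.PercRepro2

namespace CrossArm

open LocRows

variable {ι : Type*}

open scoped Classical

section Mono

/-- `redU` is monotone. -/
lemma redU_mono {s s' : Config ι} (h : s ≤ s') (hs : redU s) : redU s' := by
  obtain ⟨j, hj⟩ := hs
  exact ⟨j, Bool.le_iff_imp.1 (h j) hj⟩

/-- `ER` is monotone in the u-arm bits for a fixed fibre point. -/
lemma ER_mono {s s' : Config ι} (h : s ≤ s') (w : Fib) : ER (s, w) ⊆ ER (s', w) := by
  intro a ha
  cases a with
  | arm j => exact Bool.le_iff_imp.1 (h j) ha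
  | u => exact redU_mono h ha
  | p₁ => exact ⟨redU_mono h ha.1, ha.2⟩
  | p₂ => exact ⟨redU_mono h ha.1, ha.2⟩
  | cross => exact ⟨redU_mono h ha.1, ha.2⟩

/-- `ER` is monotone in the attachment data of the fibre for a fixed `s`. -/
lemma ER_mono_fib (s : Config ι) {w w' : Fib} (h₁ : w.att₁ = true → w'.att₁ = true)
    (h₂ : w.att₂ = true → w'.att₂ = true) (hc : w.attC = true → w'.attC = true) :
    ER (s, w) ⊆ ER (s, w') := by
  intro a ha
  cases a with
  | arm j => exact ha
  | u => exact ha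
  | p₁ => exact ⟨ha.1, h₁ ha.2⟩
  | p₂ => exact ⟨ha.1, h₂ ha.2⟩
  | cross => exact ⟨ha.1, hc ha.2⟩

/-- `flipAll` is antitone. -/
lemma flipAll_antitone {s s' : Config ι} (h : s ≤ s') : flipAll s' ≤ flipAll s := by
  intro j
  have := h j
  unfold flipAll
  cases hs : s j <;> cases hs' : s' j <;> simp_all

/-- `EB` is `ER` of the flip, spelled out. -/
lemma EB_eq (s : Config ι) (w : Fib) : EB (s, w) = ER (flipAll s, w.flip) := rfl

end Mono

section Core

variable (𝒯 : Set (TypX ι)) (𝓔 : Set (Set (AtomX ι)))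

/-- The u-arm bits at which the core fibre point `w` lies in `𝒯`. -/
def D (w : Fib) : Set (Config ι) := {s | (s, w.label) ∈ 𝒯}

/-- The u-arm bits at which `ER (·, w)` lies in `𝓔`. -/
def A (w : Fib) : Set (Config ι) := {s | ER (s, w) ∈ 𝓔}

/-- The u-arm bits at which `ER (flipAll ·, w)` lies in `𝓔`. -/
def Fl (w : Fib) : Set (Config ι) := flipAll ⁻¹' A 𝓔 w

variable {𝒯 𝓔}

/-- `D w` is a lower set. -/
lemma isLowerSet_D (h𝒯 : IsUpT 𝒯) (w : Fib) : IsLowerSet (D 𝒯 w) := by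
  intro s s' hle hs
  refine h𝒯 _ hs _ ⟨fun j hj => ?_, Label.Better_refl _⟩
  have := hle j
  simp only at hj ⊢
  rw [hj] at this
  cases h' : s' j with
  | false => rfl
  | true =>
    rw [h'] at this
    exact absurd (Bool.le_iff_imp.1 this rfl) (by decide)

/-- `A w` is an up-set. -/
lemma isUpperSet_A (h𝓔 : IsUpperSet 𝓔) (w : Fib) : IsUpperSet (A 𝓔 w) :=
  fun _ _ hle hs => h𝓔 (ER_mono hle w) hs

/-- `Fl w` is a lower set. -/
lemma isLowerSet_Fl (h𝓔 : IsUpperSet 𝓔) (w : Fib) : IsLowerSet (Fl 𝓔 w) :=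
  fun _ _ hle hs => isUpperSet_A h𝓔 w (flipAll_antitone hle) hs

/-- The flip exchanges `A w` and `Fl w`. -/
lemma flipAll_preimage_Fl (w : Fib) : flipAll ⁻¹' Fl 𝓔 w = A 𝓔 w := by
  ext s
  simp only [Fl, Set.mem_preimage, flipAll_involutive s]

/-- `D f ⊆ D a`. -/
lemma D_wf_subset (h𝒯 : IsUpT 𝒯) : D 𝒯 wf ⊆ D 𝒯 wa := fun _ hs =>
  h𝒯 _ hs _ ⟨fun _ h => h, label_wa_better_wf⟩

/-- `D d ⊆ D b`. -/
lemma D_wd_subset (h𝒯 : IsUpT 𝒯) : D 𝒯 wd ⊆ D 𝒯 wb := fun _ hs =>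
  h𝒯 _ hs _ ⟨fun _ h => h, label_wb_better_wd⟩

/-- `Fl a ⊆ Fl f`. -/
lemma Fl_wa_subset (h𝓔 : IsUpperSet 𝓔) : Fl 𝓔 wa ⊆ Fl 𝓔 wf := fun s hs =>
  h𝓔 (ER_mono_fib _ (by decide) (by decide) (by decide)) hs

/-- `Fl b ⊆ Fl d`. -/
lemma Fl_wb_subset (h𝓔 : IsUpperSet 𝓔) : Fl 𝓔 wb ⊆ Fl 𝓔 wd := fun s hs =>
  h𝓔 (ER_mono_fib _ (by decide) (by decide) (by decide)) hs

variable [Fintype ι] [DecidableEq ι]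

/-- **The cube principle on a core fibre**: `#(D w ∩ A w) ≤ #(D w ∩ Fl w)`. -/
theorem card_D_A_le (h𝒯 : IsUpT 𝒯) (h𝓔 : IsUpperSet 𝓔) (w : Fib) :
    (Finset.univ.filter (· ∈ D 𝒯 w ∩ A 𝓔 w)).card ≤
      (Finset.univ.filter (· ∈ D 𝒯 w ∩ Fl 𝓔 w)).card :=
  card_inter_le_of_cube (isLowerSet_D h𝒯 w) (isUpperSet_A h𝓔 w) (isLowerSet_Fl h𝓔 w)
    (flipAll_preimage_Fl w)

/-- The rearrangement: for `D' ⊆ D` and `F ⊆ F'`,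
`#(D ∩ F) + #(D' ∩ F') ≤ #(D ∩ F') + #(D' ∩ F)`. -/
lemma card_rearr {α : Type*} [Fintype α] {D D' F F' : Set α} (hD : D' ⊆ D) (hF : F ⊆ F') :
    (Finset.univ.filter (· ∈ D ∩ F)).card + (Finset.univ.filter (· ∈ D' ∩ F')).card ≤
      (Finset.univ.filter (· ∈ D ∩ F')).card + (Finset.univ.filter (· ∈ D' ∩ F)).card := by
  have h1 : (Finset.univ.filter (· ∈ D ∩ F')).card =
      (Finset.univ.filter (· ∈ D ∩ F)).card + (Finset.univ.filter (· ∈ D ∩ (F' \ F))).card := by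
    rw [← Finset.card_union_of_disjoint]
    · congr 1
      ext x
      simp only [Finset.mem_filter, Finset.mem_univ, true_and, Finset.mem_union, Set.mem_inter_iff,
        Set.mem_sdiff]
      constructor
      · rintro ⟨hx, hx'⟩
        by_cases hF' : x ∈ F
        · exact Or.inl ⟨hx, hF'⟩
        · exact Or.inr ⟨hx, hx', hF'⟩
      · rintro (⟨hx, hx'⟩ | ⟨hx, hx', -⟩)
        · exact ⟨hx, hF hx'⟩
        · exact ⟨hx, hx'⟩
    · rw [Finset.disjoint_left]
      intro x hx hx'
      simp only [Finset.mem_filter, Finset.mem_univ, true_and, Set.mem_inter_iff,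
        Set.mem_sdiff] at hx hx'
      exact hx'.2.2 hx.2
  have h2 : (Finset.univ.filter (· ∈ D' ∩ F')).card =
      (Finset.univ.filter (· ∈ D' ∩ F)).card + (Finset.univ.filter (· ∈ D' ∩ (F' \ F))).card := by
    rw [← Finset.card_union_of_disjoint]
    · congr 1
      ext x
      simp only [Finset.mem_filter, Finset.mem_univ, true_and, Finset.mem_union, Set.mem_inter_iff,
        Set.mem_sdiff]
      constructor
      · rintro ⟨hx, hx'⟩
        by_cases hF' : x ∈ F
        · exact Or.inl ⟨hx, hF'⟩
        · exact Or.inr ⟨hx, hx', hF'⟩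
      · rintro (⟨hx, hx'⟩ | ⟨hx, hx', -⟩)
        · exact ⟨hx, hF hx'⟩
        · exact ⟨hx, hx'⟩
    · rw [Finset.disjoint_left]
      intro x hx hx'
      simp only [Finset.mem_filter, Finset.mem_univ, true_and, Set.mem_inter_iff,
        Set.mem_sdiff] at hx hx'
      exact hx'.2.2 hx.2
  have h3 : (Finset.univ.filter (· ∈ D' ∩ (F' \ F))).card ≤
      (Finset.univ.filter (· ∈ D ∩ (F' \ F))).card := by
    apply Finset.card_le_card
    intro x hx
    simp only [Finset.mem_filter, Finset.mem_univ, true_and, Set.mem_inter_iff] at hx ⊢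
    exact ⟨hD hx.1, hx.2⟩
  omega

/-- **The core inequality**, summed over the four core fibre points, the right-hand sides with the
FLIPPED fibre (`EB (s, w) = ER (flipAll s, w.flip)`). -/
theorem core_card_le (h𝒯 : IsUpT 𝒯) (h𝓔 : IsUpperSet 𝓔) :
    (Finset.univ.filter (· ∈ D 𝒯 wa ∩ A 𝓔 wa)).card +
      (Finset.univ.filter (· ∈ D 𝒯 wb ∩ A 𝓔 wb)).card +
      (Finset.univ.filter (· ∈ D 𝒯 wd ∩ A 𝓔 wd)).card +
      (Finset.univ.filter (· ∈ D 𝒯 wf ∩ A 𝓔 wf)).card ≤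
    (Finset.univ.filter (· ∈ D 𝒯 wa ∩ Fl 𝓔 wa.flip)).card +
      (Finset.univ.filter (· ∈ D 𝒯 wb ∩ Fl 𝓔 wb.flip)).card +
      (Finset.univ.filter (· ∈ D 𝒯 wd ∩ Fl 𝓔 wd.flip)).card +
      (Finset.univ.filter (· ∈ D 𝒯 wf ∩ Fl 𝓔 wf.flip)).card := by
  rw [wa_flip, wb_flip, wd_flip, wf_flip]
  have ha := card_D_A_le h𝒯 h𝓔 wa
  have hb := card_D_A_le h𝒯 h𝓔 wb
  have hd := card_D_A_le h𝒯 h𝓔 wd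
  have hf := card_D_A_le h𝒯 h𝓔 wf
  have r1 := card_rearr (D_wf_subset h𝒯) (Fl_wa_subset h𝓔)
  have r2 := card_rearr (D_wd_subset h𝒯) (Fl_wb_subset h𝓔)
  omega

end Core

end CrossArm

end Summit.Ventures.PercRepro2
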